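import Literature.NumberTheory.EllipticCurves.Kato2004.IwasawaH1CoeffNewformLambdaTorsionProofs
import Literature.NumberTheory.EllipticCurves.Kato2004.UniversalNormsCoeffFramed
import HarnessLib

/-!
# Kato 2004 (Astérisque 295) Thm. 12.4 (2) for `𝒪_λ`-lattices: `𝐇¹_Γ(T_ρ)` is a torsion-free
# `Λ_𝒪`-module AS SOON AS `T_ρ` HAS NO NON-ZERO `Gal(ℚ̄/ℚ_∞)`-FIXED VECTOR — the compactness reduction of
# the bounded-invariants hypothesis (proofs only)

Topic `NumberTheory/EllipticCurves`, sub-directory `Kato2004` (namespace = path).  THEOREMS ONLY.  Last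
file of seat `bsd-wall-tp2-p2x-w2` g23 on the print leaf K0b (`Kato2004.thm12_4_newform`, clause
"`𝐇¹(T)` is a torsion free `Λ`-module"; item stmt-BirchSwinnertonDyer-24115 of route
`ResidualThetaTransportAtTwo`).  The sibling `IwasawaH1CoeffNewformLambdaTorsionProofs` proves
`Module.IsTorsionFree Λ_𝒪 𝐇¹_Γ(T_ρ)` under the element-wise hypothesis (HYP_J) "every `m ∈ 𝒪ⁿ` fixed by
`Γ_∞ = Gal(ℚ̄/ℚ_∞)` modulo `p^{j+J}` lies in `p^j 𝒪ⁿ`".  Here: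

* `exists_boundedInvariants_of_forall_fixed_eq_zero` — for `𝒪 = padicCoeffIntegers S` (`ℚ_p(S)/ℚ_p`
  finite), `ρ : Γ_ℚ → GL_n(𝒪)` and ANY subgroup `G ≤ Γ_ℚ`: if `𝒪ⁿ` has no non-zero `G`-fixed vector,
  then (HYP_J) holds for some `J`.  COMPACTNESS: were it to fail for every `J`, the closed subsets
  `F_J = {m : some coordinate of m is a unit, m is G-fixed modulo ϖ^J}` of the compact `𝒪ⁿ`
  (`UniversalNorms.compactSpace_padicCoeffIntegers`) would all be non-empty (divide a witness by the
  exact power `ϖ^a` of the uniformizer it contains; `(p) = (ϖ^e)`), hence (Cantor) have a common point: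
  a non-zero vector fixed modulo every `ϖ^J`, i.e. fixed (Krull) — contradiction.
* **`IwasawaH1DataCoeff.isTorsionFree_of_forall_fixed_eq_zero`** — consequently, for every pin `I` of
  `𝐇¹_Γ(T_ρ)` (`κ` a `ℤ_p`-extension with topological generator `γ`): if `T_ρ = 𝒪ⁿ` has no non-zero
  vector fixed by `Gal(ℚ̄/ℚ_∞) = ker κ`, then `𝐇¹_Γ(T_ρ)` is a torsion-free `Λ_𝒪`-module;
  `isTorsionFree_newform_of_forall_fixed_eq_zero` — the same on the binders of `thm12_4_newform`.

HONEST FRAMING.  The clause "`𝐇¹(T)` is a torsion free `Λ`-module" of Kato's Thm. 12.4 (2) for the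
lattice of a newform is now a kernel theorem modulo the single statement «`T_ρ` has no non-zero
`Gal(ℚ̄/ℚ_∞)`-fixed vector», which for `T_ρ ⊂ V_{F_λ}(g)(1)` is PRINT: purity of `V_g` (Kato (14.10.5):
Frobenius eigenvalues are Weil numbers of non-zero weight, so no open subgroup fixes a vector; the
`Γ_∞`-fixed part is a `Γ_ℚ`-stable subspace on which `Γ_ℚ` acts through the abelian `Γ`, excluded by
irreducibility / purity) — a Literature fact for a typer, not derivable from the `HasFrobCharpolyAt`
binders alone.  (12.2.1) and the rank clause of K0b are untouched; BSD is not advanced by this file.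

## References

* [Kato2004Asterisque] K. Kato, Astérisque 295 (2004): Thm. 12.4 (2) (p. 221), §13.8 (pp. 228–229),
  (14.10.5) (p. 241).
* [SerreLocalFields1979] J.-P. Serre, *Local Fields* (1979), II §1 Prop. 1 (compactness of `𝒪`).
-/

noncomputable section

open scoped NumberField
open Field CategoryTheory Topology Polynomial
open Literature.NumberTheory.GaloisRepresentations
open Literature.NumberTheory.EllipticCurves Literature.NumberTheory.EllipticCurves.Kato2004
open Literature.NumberTheory.EllipticCurves.Kato2004.EulerSystemValues

namespace Literature.NumberTheory.EllipticCurves.Kato2004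

namespace IwasawaH1CoeffTorsionFree

variable {p : ℕ} [Fact p.Prime] (S : Set (PadicAlgCl p)) [FiniteDimensional ℚ_[p] (padicCoeffField S)]

omit [FiniteDimensional ℚ_[p] (padicCoeffField S)] in
/-- A unit of `𝒪` has norm `1` in `ℚ̄_p`. [folklore] -/
private theorem norm_eq_one_of_isUnit {x : padicCoeffIntegers S} (hx : IsUnit x) :
    ‖(x : PadicAlgCl p)‖ = 1 := by
  obtain ⟨u, rfl⟩ := hx
  have h1 : ‖((u : padicCoeffIntegers S) : PadicAlgCl p)‖ * ‖((↑u⁻¹ : padicCoeffIntegers S) : PadicAlgCl p)‖ = 1 := by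
    rw [← norm_mul, ← Subring.coe_mul, Units.mul_inv, Subring.coe_one, norm_one]
  have ha := (u : padicCoeffIntegers S).2.2
  have hb := (↑u⁻¹ : padicCoeffIntegers S).2.2
  nlinarith [norm_nonneg ((u : padicCoeffIntegers S) : PadicAlgCl p),
    norm_nonneg ((↑u⁻¹ : padicCoeffIntegers S) : PadicAlgCl p)]

/-- **No non-zero `G`-fixed vector ⟹ bounded `G`-invariants modulo powers of `p`.**  For
`𝒪 = padicCoeffIntegers S` with `ℚ_p(S)/ℚ_p` finite, `ρ : Γ_ℚ → GL_n(𝒪)` and a subgroup `G ≤ Γ_ℚ` such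
that `ρ(g) m = m` for all `g ∈ G` forces `m = 0`: there is `J` with — for all `j` and `m ∈ 𝒪ⁿ` — if
`ρ(g) m − m ∈ p^{j+J} 𝒪ⁿ` for all `g ∈ G` then `m ∈ p^j 𝒪ⁿ` (i.e. `(𝒪ⁿ ⊗ ℚ / 𝒪ⁿ)^G` is killed by
`p^J`).  Proof by compactness of `𝒪ⁿ` and Cantor's intersection theorem applied to the closed sets
`{m : some mᵢ is a unit, m is G-fixed mod ϖ^J}` (see the module docstring).
[cite: SerreLocalFields1979, II §1 Prop. 1] [cite: Kato2004Asterisque, §13.8 (pp. 228–229)] -/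
theorem exists_boundedInvariants_of_forall_fixed_eq_zero {n : ℕ}
    (ρ : FramedGaloisRep ℚ (padicCoeffIntegers S) n) (G : Subgroup (absoluteGaloisGroup ℚ))
    (hfix : ∀ m : Fin n → padicCoeffIntegers S, (∀ g ∈ G, ρ.toGaloisRep g m = m) → m = 0) :
    ∃ J : ℕ, ∀ (j : ℕ) (m : Fin n → padicCoeffIntegers S),
      (∀ g ∈ G, ∃ t : Fin n → padicCoeffIntegers S,
        ((p : ℕ) : padicCoeffIntegers S) ^ (j + J) • t = ρ.toGaloisRep g m - m) →
      ∃ t : Fin n → padicCoeffIntegers S, ((p : ℕ) : padicCoeffIntegers S) ^ j • t = m := by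
  haveI : IsPrincipalIdealRing (padicCoeffIntegers S) := isPrincipalIdealRing_padicCoeffIntegers S
  haveI : IsLocalRing (padicCoeffIntegers S) := isLocalRing_padicCoeffIntegers S
  haveI := IwasawaH1CoeffExists.isAdicComplete_maximalIdeal_padicCoeffIntegers p S
  haveI := isDiscreteValuationRing_padicCoeffIntegers S
  haveI : CompactSpace (padicCoeffIntegers S) := UniversalNorms.compactSpace_padicCoeffIntegers S
  obtain ⟨ϖ, hϖ⟩ := IsDiscreteValuationRing.exists_irreducible (padicCoeffIntegers S)
  have hmax := hϖ.maximalIdeal_eq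
  -- `p = ϖ^e u` with `e ≥ 1`
  obtain ⟨e, he0, he⟩ := exists_maximalIdeal_pow_eq_span_natCast S
  rw [hmax, Ideal.span_singleton_pow, Ideal.span_singleton_eq_span_singleton] at he
  obtain ⟨u, hu⟩ := he
  -- the closed sets `F J = {m : some coordinate is a unit, m is G-fixed modulo ϖ^J}`
  set M := Fin n → padicCoeffIntegers S with hM
  let F : ℕ → Set M := fun J ↦
    (⋃ i : Fin n, {m : M | ‖((m i : padicCoeffIntegers S) : PadicAlgCl p)‖ = 1}) ∩
      ⋂ g ∈ G, (fun m : M ↦ ρ.toGaloisRep g m - m) ⁻¹' Set.range (fun t : M ↦ ϖ ^ J • t)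
  have hFclosed : ∀ J, IsClosed (F J) := by
    intro J
    refine IsClosed.inter (isClosed_iUnion_of_finite fun i ↦ isClosed_eq ?_ continuous_const)
      (isClosed_biInter fun g _ ↦ IsClosed.preimage ?_ ?_)
    · exact continuous_norm.comp (continuous_subtype_val.comp (continuous_apply i))
    · exact ((ρ.toGaloisRep).continuous_apply g).sub continuous_id
    · exact (isCompact_range (continuous_id.const_smul (ϖ ^ J))).isClosed
  have hFanti : Antitone F := by
    intro J J' hJJ' m hm
    refine ⟨hm.1, ?_⟩
    have h2 := hm.2
    simp only [Set.mem_iInter, Set.mem_preimage, Set.mem_range] at h2 ⊢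
    intro g hg
    obtain ⟨t, ht⟩ := h2 g hg
    exact ⟨ϖ ^ (J' - J) • t, by rw [smul_smul, ← pow_add, Nat.add_sub_cancel' hJJ', ht]⟩
  -- if (HYP_J) failed for every `J`, every `F J` would be non-empty
  by_contra hcon
  push Not at hcon
  have hFne : ∀ J, (F J).Nonempty := by
    intro J
    obtain ⟨j, m, hmfix, hmnot⟩ := hcon J
    -- `m ∉ p^j M`, so not every coordinate is divisible by `ϖ^{ej}`; let `a` be the `ϖ`-adic valuation of `m`
    have hj : j ≠ 0 := by rintro rfl; exact hmnot m (by rw [pow_zero, one_smul])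
    have hej : 1 ≤ e * j := Nat.one_le_iff_ne_zero.mpr (Nat.mul_ne_zero he0.ne' hj)
    have hQ' : ¬ ∀ i, ϖ ^ (e * j - 1 + 1) ∣ m i := by
      intro hall
      choose c hc using hall
      refine hmnot (fun i ↦ ↑(u⁻¹ ^ j) * c i) (funext fun i ↦ ?_)
      rw [Pi.smul_apply, smul_eq_mul, hc i, Nat.sub_add_cancel hej, ← hu, mul_pow, ← pow_mul,
        ← Units.val_pow_eq_pow_val, mul_assoc, ← mul_assoc (↑(u ^ j) : padicCoeffIntegers S),
        ← Units.val_mul, inv_pow, mul_inv_cancel, Units.val_one, one_mul]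
    have hQ : ∃ a, ¬ ∀ i, ϖ ^ (a + 1) ∣ m i := ⟨_, hQ'⟩
    classical
    set a := Nat.find hQ with ha_def
    have ha : ¬ ∀ i, ϖ ^ (a + 1) ∣ m i := Nat.find_spec hQ
    have hae : a ≤ e * j - 1 := Nat.find_le hQ'
    have hdiv : ∀ i, ϖ ^ a ∣ m i := by
      intro i
      rcases Nat.eq_zero_or_pos a with h0 | hpos
      · rw [h0, pow_zero]; exact one_dvd _
      · have hmin := Nat.find_min hQ (m := a - 1) (by omega)
        push Not at hmin
        have := hmin i
        rwa [Nat.sub_add_cancel hpos] at this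
    choose m' hm' using hdiv
    have hmm' : m = ϖ ^ a • (m' : M) := funext fun i ↦ by rw [Pi.smul_apply, smul_eq_mul, hm']
    -- some coordinate of `m'` is a unit
    obtain ⟨i₀, hi₀⟩ : ∃ i, ¬ ϖ ^ (a + 1) ∣ m i := by
      by_contra h; push Not at h; exact ha h
    have hunit : IsUnit (m' i₀) := by
      by_contra hnu
      have hmem : m' i₀ ∈ IsLocalRing.maximalIdeal (padicCoeffIntegers S) := hnu
      rw [hmax, Ideal.mem_span_singleton] at hmem
      obtain ⟨c, hc⟩ := hmem
      exact hi₀ ⟨c, by rw [hm', hc, pow_succ, mul_assoc]⟩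
    -- `m'` is `G`-fixed modulo `ϖ^J`
    refine ⟨m', Set.mem_iUnion.mpr ⟨i₀, norm_eq_one_of_isUnit S hunit⟩, ?_⟩
    simp only [Set.mem_iInter, Set.mem_preimage, Set.mem_range]
    intro g hg
    obtain ⟨t, ht⟩ := hmfix g hg
    have hpow : ((p : ℕ) : padicCoeffIntegers S) ^ (j + J) = ϖ ^ a * (ϖ ^ (e * (j + J) - a) * ↑(u ^ (j + J))) := by
      have hale : a ≤ e * (j + J) :=
        hae.trans ((Nat.sub_le _ _).trans (by rw [mul_add]; exact Nat.le_add_right _ _))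
      rw [← mul_assoc, ← pow_add, Nat.add_sub_cancel' hale, ← hu, mul_pow, ← pow_mul,
        Units.val_pow_eq_pow_val]
    have hcancel : ρ.toGaloisRep g m' - m' = (ϖ ^ (e * (j + J) - a) * ↑(u ^ (j + J))) • t := by
      apply smul_right_injective M (pow_ne_zero a hϖ.ne_zero)
      change ϖ ^ a • (ρ.toGaloisRep g m' - m') = ϖ ^ a • ((ϖ ^ (e * (j + J) - a) * ↑(u ^ (j + J))) • t)
      rw [smul_sub, ← map_smul, ← hmm', ← ht, smul_smul, hpow]
    refine ⟨(ϖ ^ (e * (j + J) - a - J) * ↑(u ^ (j + J))) • t, ?_⟩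
    rw [hcancel, smul_smul, ← mul_assoc, ← pow_add]
    congr 3
    have : J ≤ e * (j + J) - a := by
      have h1 : e * (j + J) = e * j + e * J := by ring
      have h2 : J ≤ e * J := Nat.le_mul_of_pos_left J he0
      omega
    omega
  -- Cantor's intersection theorem in the compact `𝒪ⁿ`
  obtain ⟨m, hm⟩ := IsCompact.nonempty_iInter_of_directed_nonempty_isCompact_isClosed F
    hFanti.directed_ge hFne (fun J ↦ (hFclosed J).isCompact) hFclosed
  rw [Set.mem_iInter] at hm
  -- `m` is `G`-fixed …
  have hmfix : ∀ g ∈ G, ρ.toGaloisRep g m = m := by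
    intro g hg
    rw [← sub_eq_zero]
    funext i
    refine IsHausdorff.haus (inferInstance : IsHausdorff
      (IsLocalRing.maximalIdeal (padicCoeffIntegers S)) (padicCoeffIntegers S)) _ fun J ↦ ?_
    have h2 := (hm J).2
    simp only [Set.mem_iInter, Set.mem_preimage, Set.mem_range] at h2
    obtain ⟨t, ht⟩ := h2 g hg
    rw [SModEq.sub_mem, sub_zero, smul_eq_mul, Ideal.mul_top, hmax, Ideal.span_singleton_pow,
      ← ht, Pi.smul_apply, smul_eq_mul]
    exact Ideal.mul_mem_right _ _ (Ideal.mem_span_singleton_self _)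
  -- … and non-zero: contradiction
  have hm0 : m = 0 := hfix m hmfix
  obtain ⟨i, hi⟩ := Set.mem_iUnion.mp (hm 0).1
  rw [hm0] at hi
  have hi' : ‖(((0 : M) i : padicCoeffIntegers S) : PadicAlgCl p)‖ = 1 := hi
  rw [Pi.zero_apply, ZeroMemClass.coe_zero, norm_zero] at hi'
  exact zero_ne_one hi'

end IwasawaH1CoeffTorsionFree


namespace IwasawaH1DataCoeff

open IwasawaH1CoeffTorsionFree

variable {p : ℕ} [Fact p.Prime] {S : Set (PadicAlgCl p)} [FiniteDimensional ℚ_[p] (padicCoeffField S)]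
  {n : ℕ} {ρ : FramedGaloisRep ℚ (padicCoeffIntegers S) n} {κ : ZpExtension ℚ p} {γ : absoluteGaloisGroup ℚ}

/-- **Kato Thm. 12.4 (2) for `𝒪_λ`-lattices without `Gal(ℚ̄/ℚ_∞)`-fixed vectors: `𝐇¹_Γ(T_ρ)` is a
TORSION-FREE `Λ_𝒪`-module.**  For `𝒪 = padicCoeffIntegers S` (`ℚ_p(S)/ℚ_p` finite), every
`ρ : Γ_ℚ → GL_n(𝒪)`, every prime `p`, every `ℤ_p`-extension `κ` of `ℚ` with topological generator `γ`,
and every pin `I : IwasawaH1DataCoeff ρ.toGaloisRep p κ γ`: if the only vector of `T_ρ = 𝒪ⁿ` fixed by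
`ker κ = Gal(ℚ̄/ℚ_∞)` is `0`, then `Module.IsTorsionFree Λ_𝒪 I.H`
(`exists_boundedInvariants_of_forall_fixed_eq_zero` + `isTorsionFree_of_boundedInvariants`).
[cite: Kato2004Asterisque, Thm. 12.4 (2) (p. 221), §13.8 (pp. 228–229) and (14.10.5) (p. 241)] -/
theorem isTorsionFree_of_forall_fixed_eq_zero (I : IwasawaH1DataCoeff ρ.toGaloisRep p κ γ)
    (hγ : κ.IsTopGenerator γ)
    (hfix : ∀ m : Fin n → padicCoeffIntegers S, (∀ g ∈ κ.kerSubgroup, ρ.toGaloisRep g m = m) → m = 0) :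
    Module.IsTorsionFree (IwasawaAlgebraO S) I.H := by
  obtain ⟨J, hJ⟩ := exists_boundedInvariants_of_forall_fixed_eq_zero S ρ κ.kerSubgroup hfix
  exact I.isTorsionFree_of_boundedInvariants hγ J hJ

/-- **K0b clause (b) on its own binders, modulo «no `Gal(ℚ̄/ℚ_∞)`-fixed vector».**  For every prime `p`,
`g ∈ S₂(Γ₀(M))` with `IsNewform0 g`, `ι : K_g → ℚ̄_p`, lattice `ρ : Γ_ℚ → GL₂(𝒪)`
(`𝒪 = padicCoeffIntegers (Set.range ι)`), cyclotomic `κ` with topological generator `γ` and datum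
`I : IwasawaH1DataCoeff ρ.toGaloisRep p κ γ`: if `T_ρ` has no non-zero `Gal(ℚ̄/ℚ_∞)`-fixed vector, then
`Module.IsTorsionFree Λ_𝒪 I.H` — the middle conjunct of `thm12_4_newform`.  The remaining input is
print (purity (14.10.5) / irreducibility of `V_g`); the Frobenius hypothesis of the fact is not taken.
[cite: Kato2004Asterisque, Thm. 12.4 (2) (p. 221) and (14.10.5) (p. 241)] -/
theorem isTorsionFree_newform_of_forall_fixed_eq_zero {p : ℕ} [Fact p.Prime] {M : ℕ} [NeZero M]
    {g : CuspForm (CongruenceSubgroup.Gamma0 M) 2} (ι : ModularForms.coeffField g →+* PadicAlgCl p)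
    {ρ : FramedGaloisRep ℚ (padicCoeffIntegers (Set.range ι)) 2}
    {κ : ZpExtension ℚ p} {γ : absoluteGaloisGroup ℚ} (hg : ModularForms.IsNewform0 g)
    (hγ : κ.IsTopGenerator γ) (I : IwasawaH1DataCoeff ρ.toGaloisRep p κ γ)
    (hfix : ∀ m : Fin 2 → padicCoeffIntegers (Set.range ι),
      (∀ σ ∈ κ.kerSubgroup, ρ.toGaloisRep σ m = m) → m = 0) :
    Module.IsTorsionFree (IwasawaAlgebraO (Set.range ι)) I.H := by
  haveI : FiniteDimensional ℚ (ModularForms.coeffField g) :=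
    ModularForms.IsNewform0.finiteDimensional_coeffField_holds hg
  haveI : FiniteDimensional ℚ_[p] (padicCoeffField (Set.range ι)) :=
    GreenbergSelmer.finiteDimensional_padicCoeffField ι
  exact I.isTorsionFree_of_forall_fixed_eq_zero hγ hfix

end IwasawaH1DataCoeff

end Literature.NumberTheory.EllipticCurves.Kato2004

end
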